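import Summits.ResolutionOfSingularities.ResolutionOfSingularities.Theses.SyzygyFlattening
import Literature.AlgebraicGeometry.Resolution.RegularLocalRingsNormal
import HarnessLib

/-!
# `SyzygyFlattening.Globalisation` (crux stmt-ResolutionOfSingularities-17061): the antecedent is not
# junk-TRUE — its natural strengthening "stage `m = 0` already regular" is FALSE (the cusp)
# (negative-side support; this file does NOT refute the crux, which is implied by the summit)

The antecedent `DZT p` of the crux asks that the syzygy-flattening tower `T₀ = loc A`,
`T_(m+1) = loc (nrm (chart T_m))` reach a regular local ring at SOME stage `m`. Recorded here,
sorry-free and without introducing any definition: the strengthening with `∃ m` replaced by `m = 0`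
("the local ring of the affine model at the centre of the valuation is already regular") fails in
every prime characteristic, at the cusp:

* `k = 𝔽_p`, `K = k(t)` (`RatFunc`), `O = k[t]_(t)` (the `t`-adic valuation ring — discrete rank one,
  residue field `k`, so DIMENSION ZERO), `A = k[t², t³]` (finitely generated, `Frac A = K`, `A ⊆ O`);
* `T₀ = loc A = k[t², t³]_(t², t³)` is NOT regular: a regular local ring is integrally closed
  (Matsumura 19.4, `isIntegrallyClosed_of_isRegularLocalRing` in the tree), `t² ∈ T₀`, but `t ∉ T₀` —
  every element `z` of `T₀` satisfies `z ≡ c (mod t²·O)` for a constant `c` (`cusp_envelope`), and `t`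
  does not.

So the hypothesis handed to `Globalisation` is a genuine TERMINATION statement (some blow-ups are
needed), not dischargeable at `m = 0`; together with `SyzygyTowerFalseWithoutFG.lean` (the `FG`-free
antecedent is false) this brackets the antecedent between junk-false and junk-true.
-/

noncomputable section

-- single-problem summit: the doubled namespace component is forced by the tree layout
set_option linter.dupNamespace false

namespace Summit.ResolutionOfSingularities.ResolutionOfSingularities.Theorems.Globalisation.Negative

open IsDedekindDomain

section Cusp

variable {k : Type} [Field k]

/-- Constants: `algebraMap k k(t) c = algebraMap k[X] k(t) (C c)`. [folklore] -/
theorem cusp_algebraMap (c : k) :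
    algebraMap k (RatFunc k) c = algebraMap (Polynomial k) (RatFunc k) (Polynomial.C c) := by
  rw [IsScalarTower.algebraMap_apply k (Polynomial k) (RatFunc k), Polynomial.algebraMap_eq]

variable (v : Valuation (RatFunc k) (WithZero (Multiplicative ℤ)))
  (hv : v = (Polynomial.idealX k).valuation (RatFunc k))
include hv

/-- `v(t) = exp(-1)`. [folklore] -/
theorem cusp_v_X : v RatFunc.X = WithZero.exp (-1 : ℤ) := by
  subst hv
  exact Polynomial.valuation_X_eq_neg_one k

/-- Non-zero constants have `v = 1`. [folklore] -/
theorem cusp_v_C {c : k} (hc : c ≠ 0) : v (algebraMap k (RatFunc k) c) = 1 := by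
  subst hv
  rw [cusp_algebraMap, HeightOneSpectrum.valuation_eq_one_iff_notMem, Polynomial.idealX_span,
    Ideal.mem_span_singleton, Polynomial.X_dvd_iff, Polynomial.coeff_C_zero]
  exact hc

/-- Constants have `v ≤ 1`. [folklore] -/
theorem cusp_v_C_le (c : k) : v (algebraMap k (RatFunc k) c) ≤ 1 := by
  by_cases hc : c = 0
  · rw [hc, map_zero, map_zero]; exact zero_le
  · exact (cusp_v_C v hv hc).le

/-- **The envelope.** `S = {z : v z ≤ 1 ∧ ∃ c ∈ k, v (z - c) ≤ exp(-2)}` ("`z ∈ O` and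
`z ≡ const (mod t² O)`") is a `k`-subalgebra of `k(t)`. [folklore] -/
theorem cusp_envelope :
    ∃ S : Subalgebra k (RatFunc k), ∀ z, z ∈ S ↔
      v z ≤ 1 ∧ ∃ c : k, v (z - algebraMap k (RatFunc k) c) ≤ WithZero.exp (-2 : ℤ) := by
  refine ⟨{ carrier := {z | v z ≤ 1 ∧ ∃ c : k, v (z - algebraMap k (RatFunc k) c) ≤ WithZero.exp (-2 : ℤ)}
            mul_mem' := ?_, one_mem' := ?_, add_mem' := ?_, zero_mem' := ?_,
            algebraMap_mem' := ?_ }, fun z => Iff.rfl⟩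
  · rintro a b ⟨ha, c, hc⟩ ⟨hb, d, hd⟩
    refine ⟨?_, c * d, ?_⟩
    · rw [map_mul]; exact mul_le_one' ha hb
    · have : a * b - algebraMap k (RatFunc k) (c * d) =
          a * (b - algebraMap k (RatFunc k) d) + (a - algebraMap k (RatFunc k) c) *
            algebraMap k (RatFunc k) d := by
        rw [map_mul]; ring
      rw [this]
      refine v.map_add_le ?_ ?_
      · rw [map_mul]
        calc v a * v (b - algebraMap k (RatFunc k) d) ≤ 1 * WithZero.exp (-2 : ℤ) :=
              mul_le_mul' ha hd
          _ = _ := one_mul _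
      · rw [map_mul]
        calc v (a - algebraMap k (RatFunc k) c) * v (algebraMap k (RatFunc k) d)
              ≤ WithZero.exp (-2 : ℤ) * 1 := mul_le_mul' hc (cusp_v_C_le v hv d)
          _ = _ := mul_one _
  · refine ⟨by rw [map_one], 1, ?_⟩
    rw [map_one, sub_self, map_zero]; exact zero_le
  · rintro a b ⟨ha, c, hc⟩ ⟨hb, d, hd⟩
    refine ⟨v.map_add_le ha hb, c + d, ?_⟩
    have : a + b - algebraMap k (RatFunc k) (c + d) =
        (a - algebraMap k (RatFunc k) c) + (b - algebraMap k (RatFunc k) d) := by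
      rw [map_add]; ring
    rw [this]
    exact v.map_add_le hc hd
  · refine ⟨by rw [map_zero]; exact zero_le, 0, ?_⟩
    rw [map_zero, sub_zero, map_zero]; exact zero_le
  · intro r
    refine ⟨cusp_v_C_le v hv r, r, ?_⟩
    rw [sub_self, map_zero]; exact zero_le

/-- `t²` and `t³` lie in the envelope. [folklore] -/
theorem cusp_pow_mem_envelope (S : Subalgebra k (RatFunc k))
    (hS : ∀ z, z ∈ S ↔ v z ≤ 1 ∧ ∃ c : k, v (z - algebraMap k (RatFunc k) c) ≤ WithZero.exp (-2 : ℤ))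
    (n : ℕ) (hn : 2 ≤ n) : (RatFunc.X : RatFunc k) ^ n ∈ S := by
  have hX := cusp_v_X v hv
  have hvn : v ((RatFunc.X : RatFunc k) ^ n) = WithZero.exp (-(n : ℤ)) := by
    rw [map_pow, hX, ← WithZero.exp_nsmul]
    congr 1
    simp
  refine (hS _).2 ⟨?_, 0, ?_⟩
  · rw [hvn, ← WithZero.exp_zero, WithZero.exp_le_exp]; omega
  · rw [map_zero, sub_zero, hvn, WithZero.exp_le_exp]; omega

/-- `t` is NOT in the envelope. [folklore] -/
theorem cusp_X_not_mem_envelope (S : Subalgebra k (RatFunc k))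
    (hS : ∀ z, z ∈ S ↔ v z ≤ 1 ∧ ∃ c : k, v (z - algebraMap k (RatFunc k) c) ≤ WithZero.exp (-2 : ℤ)) :
    (RatFunc.X : RatFunc k) ∉ S := by
  rintro hX
  obtain ⟨-, c, hc⟩ := (hS _).1 hX
  have hvX := cusp_v_X v hv
  by_cases hc0 : c = 0
  · rw [hc0, map_zero, sub_zero, hvX, WithZero.exp_le_exp] at hc
    omega
  · have hne : v (RatFunc.X : RatFunc k) ≠ v (-algebraMap k (RatFunc k) c) := by
      rw [Valuation.map_neg, cusp_v_C v hv hc0, hvX, ← WithZero.exp_zero, Ne,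
        WithZero.exp_inj]
      omega
    have := Valuation.map_add_of_distinct_val v hne
    rw [← sub_eq_add_neg, Valuation.map_neg, cusp_v_C v hv hc0, hvX] at this
    rw [this, ← WithZero.exp_zero, max_le_iff, WithZero.exp_le_exp, WithZero.exp_le_exp] at hc
    omega

/-- The envelope contains `loc A` for `A = k[t², t³]` and `O = {v ≤ 1}`: it contains `A`, and it is
closed under inverting `O`-units (`s ≡ d ≠ 0 (mod t²) ⇒ s⁻¹ ≡ d⁻¹ (mod t²)`). [folklore] -/
theorem cusp_loc_le_envelope (O : ValuationSubring (RatFunc k)) (hO : ∀ z, z ∈ O ↔ v z ≤ 1)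
    (S : Subalgebra k (RatFunc k))
    (hS : ∀ z, z ∈ S ↔ v z ≤ 1 ∧ ∃ c : k, v (z - algebraMap k (RatFunc k) c) ≤ WithZero.exp (-2 : ℤ)) :
    Algebra.adjoin k {y : RatFunc k | ∃ a ∈ Algebra.adjoin k {(RatFunc.X : RatFunc k) ^ 2, (RatFunc.X : RatFunc k) ^ 3}, ∃ s ∈ Algebra.adjoin k {(RatFunc.X : RatFunc k) ^ 2, (RatFunc.X : RatFunc k) ^ 3}, s⁻¹ ∈ O ∧ y = a * s⁻¹} ≤ S := by
  have hAS : Algebra.adjoin k {(RatFunc.X : RatFunc k) ^ 2, (RatFunc.X : RatFunc k) ^ 3} ≤ S := by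
    refine Algebra.adjoin_le ?_
    rintro z (rfl | rfl)
    · exact cusp_pow_mem_envelope v hv S hS 2 le_rfl
    · exact cusp_pow_mem_envelope v hv S hS 3 (by norm_num)
  refine Algebra.adjoin_le ?_
  rintro y ⟨a, ha, s, hs, hsO, rfl⟩
  refine S.mul_mem (hAS ha) ?_
  -- `s⁻¹ ∈ S`
  by_cases hs0 : s = 0
  · rw [hs0, inv_zero]; exact S.zero_mem
  obtain ⟨hs1, d, hd⟩ := (hS s).1 (hAS hs)
  have hsinv1 : v s⁻¹ ≤ 1 := (hO _).1 hsO
  have hvs : v s = 1 := by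
    refine le_antisymm hs1 ?_
    rw [map_inv₀] at hsinv1
    exact (inv_le_one₀ (zero_lt_iff.2 ((Valuation.ne_zero_iff v).2 hs0))).1 hsinv1
  have hd0 : d ≠ 0 := by
    rintro rfl
    rw [map_zero, sub_zero, hvs, ← WithZero.exp_zero, WithZero.exp_le_exp] at hd
    omega
  have hvd : v (algebraMap k (RatFunc k) d) = 1 := cusp_v_C v hv hd0
  have hd0' : algebraMap k (RatFunc k) d ≠ 0 := by
    intro h; rw [h, map_zero] at hvd; exact zero_ne_one hvd
  refine (hS _).2 ⟨(hO _).1 hsO, d⁻¹, ?_⟩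
  rw [map_inv₀, inv_sub_inv hs0 hd0', map_div₀, map_mul, hvs, hvd, mul_one, div_one,
    Valuation.map_sub_swap]
  exact hd

omit hv in
/-- Every polynomial multiple of `t²` lies in `A = k[t², t³]`. [folklore] -/
theorem cusp_mul_X_sq_mem (f : Polynomial k) :
    algebraMap (Polynomial k) (RatFunc k) (f * Polynomial.X ^ 2) ∈
      Algebra.adjoin k {(RatFunc.X : RatFunc k) ^ 2, (RatFunc.X : RatFunc k) ^ 3} := by
  have hpow : ∀ n : ℕ, 2 ≤ n → (RatFunc.X : RatFunc k) ^ n ∈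
      Algebra.adjoin k {(RatFunc.X : RatFunc k) ^ 2, (RatFunc.X : RatFunc k) ^ 3} := by
    intro n hn
    induction n using Nat.strong_induction_on with
    | _ n ih =>
      rcases Nat.lt_or_ge n 4 with h | h
      · interval_cases n
        · exact Algebra.subset_adjoin (Set.mem_insert _ _)
        · exact Algebra.subset_adjoin (Set.mem_insert_of_mem _ rfl)
      · have : (RatFunc.X : RatFunc k) ^ n = RatFunc.X ^ 2 * RatFunc.X ^ (n - 2) := by
          rw [← pow_add]; congr 1; omega
        rw [this]
        exact Subalgebra.mul_mem _ (Algebra.subset_adjoin (Set.mem_insert _ _))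
          (ih (n - 2) (by omega) (by omega))
  induction f using Polynomial.induction_on' with
  | add p q hp hq => rw [add_mul, map_add]; exact add_mem hp hq
  | monomial n a =>
    rw [← Polynomial.C_mul_X_pow_eq_monomial, mul_assoc, ← pow_add, map_mul, map_pow,
      RatFunc.algebraMap_X, RatFunc.algebraMap_C, ← RatFunc.algebraMap_eq_C]
    exact Subalgebra.mul_mem _ (Subalgebra.algebraMap_mem _ a) (hpow (n + 2) (by omega))

omit hv in
/-- Any `k`-subalgebra of `k(t)` containing `A = k[t², t³]` has fraction field `k(t)`
(`f/g = (f t²)/(g t²)`). [folklore] -/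
theorem cusp_isFractionRing (L : Subalgebra k (RatFunc k))
    (hL : Algebra.adjoin k {(RatFunc.X : RatFunc k) ^ 2, (RatFunc.X : RatFunc k) ^ 3} ≤ L) :
    IsFractionRing ↥L (RatFunc k) := by
  refine IsFractionRing.of_field (R := ↥L) (K := RatFunc k) (surj := fun z => ?_)
  refine ⟨⟨_, hL (cusp_mul_X_sq_mem z.num)⟩, ⟨_, hL (cusp_mul_X_sq_mem z.denom)⟩, ?_⟩
  show z = algebraMap (Polynomial k) (RatFunc k) (z.num * Polynomial.X ^ 2) /
    algebraMap (Polynomial k) (RatFunc k) (z.denom * Polynomial.X ^ 2)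
  have hX2 : algebraMap (Polynomial k) (RatFunc k) (Polynomial.X ^ 2) ≠ 0 := by
    rw [map_pow, RatFunc.algebraMap_X]; exact pow_ne_zero _ RatFunc.X_ne_zero
  rw [map_mul, map_mul, mul_div_mul_right _ _ hX2, RatFunc.num_div_denom]

/-- The `t`-adic valuation ring has DIMENSION ZERO over `k`: the residue of `y = p/q` (`q(0) ≠ 0`) is
the constant `p(0)/q(0)`. [folklore] -/
theorem cusp_dimZero (O : ValuationSubring (RatFunc k)) (hO : ∀ z, z ∈ O ↔ v z ≤ 1)
    (y : RatFunc k) (hy : y ∈ O) :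
    ∃ f : Polynomial k, f ≠ 0 ∧ O.valuation (Polynomial.aeval y f) < 1 := by
  subst hv
  have hq : y.denom ≠ 0 := y.denom_ne_zero
  have hy' : y = algebraMap _ _ y.num / algebraMap _ _ y.denom := (RatFunc.num_div_denom y).symm
  have hvy : (Polynomial.idealX k).valuation (RatFunc k) y ≤ 1 := (hO y).1 hy
  have hqX : y.denom ∉ (Polynomial.idealX k).asIdeal := by
    rw [hy'] at hvy
    refine (HeightOneSpectrum.valuation_div_le_one_iff (RatFunc k) (Polynomial.idealX k) y.num hq ?_).1 hvy
    intro hqmem hpmem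
    rw [Polynomial.idealX_span, Ideal.mem_span_singleton] at hqmem hpmem
    obtain ⟨a, b, hab⟩ := RatFunc.isCoprime_num_denom y
    have h1 : (Polynomial.X : Polynomial k) ∣ 1 :=
      hab ▸ dvd_add (dvd_mul_of_dvd_right hpmem _) (dvd_mul_of_dvd_right hqmem _)
    exact Polynomial.not_isUnit_X (isUnit_of_dvd_one h1)
  have hq0 : y.denom.coeff 0 ≠ 0 := by
    intro h; apply hqX
    rw [Polynomial.idealX_span, Ideal.mem_span_singleton, Polynomial.X_dvd_iff]; exact h
  set c : k := y.num.coeff 0 / y.denom.coeff 0 with hc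
  refine ⟨Polynomial.X - Polynomial.C c, Polynomial.X_sub_C_ne_zero c, ?_⟩
  rw [map_sub, Polynomial.aeval_X, Polynomial.aeval_C]
  rw [← ValuationSubring.mem_nonunits_iff, ValuationSubring.mem_nonunits_iff_or]
  suffices h : (Polynomial.idealX k).valuation (RatFunc k) (y - algebraMap k (RatFunc k) c) < 1 by
    by_cases h0 : y - algebraMap k (RatFunc k) c = 0
    · exact Or.inl h0
    · right
      intro hmem
      have h1 := (hO _).1 hmem
      rw [map_inv₀] at h1
      have hne : (Polynomial.idealX k).valuation (RatFunc k) (y - algebraMap k (RatFunc k) c) ≠ 0 :=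
        (Valuation.ne_zero_iff _).2 h0
      exact absurd ((inv_le_one₀ (zero_lt_iff.2 hne)).1 h1) (not_le.2 h)
  have hq' : algebraMap (Polynomial k) (RatFunc k) y.denom ≠ 0 := by
    simpa using hq
  have hyc : y - algebraMap k (RatFunc k) c =
      algebraMap (Polynomial k) (RatFunc k) (y.num - Polynomial.C c * y.denom) /
        algebraMap (Polynomial k) (RatFunc k) y.denom := by
    rw [map_sub, map_mul, ← cusp_algebraMap, sub_div, mul_div_assoc, div_self hq', mul_one,
      ← hy']
  rw [hyc, map_div₀, ((Polynomial.idealX k).valuation_eq_one_iff_notMem).2 hqX, div_one]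
  refine ((Polynomial.idealX k).valuation_lt_one_iff_mem _).2 ?_
  rw [Polynomial.idealX_span, Ideal.mem_span_singleton, Polynomial.X_dvd_iff, Polynomial.coeff_sub,
    Polynomial.coeff_C_mul, hc, div_mul_cancel₀ _ hq0, sub_self]

omit hv in
/-- `loc A` is not a regular local ring once it misses `t` but contains `t²`: regular local rings are
integrally closed (Matsumura 19.4, in the tree). [cite: Matsumura1987, Thm. 19.4] -/
theorem cusp_not_isRegularLocalRing (L : Subalgebra k (RatFunc k))
    (hL : Algebra.adjoin k {(RatFunc.X : RatFunc k) ^ 2, (RatFunc.X : RatFunc k) ^ 3} ≤ L)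
    (hXL : (RatFunc.X : RatFunc k) ∉ L) : ¬ IsRegularLocalRing ↥L := by
  intro hreg
  haveI : IsFractionRing ↥L (RatFunc k) := cusp_isFractionRing L hL
  haveI : IsIntegrallyClosed ↥L :=
    Literature.AlgebraicGeometry.Resolution.isIntegrallyClosed_of_isRegularLocalRing ↥L
  have hX2 : (RatFunc.X : RatFunc k) ^ 2 ∈ L := hL (Algebra.subset_adjoin (Set.mem_insert _ _))
  obtain ⟨y, hy⟩ := IsIntegrallyClosed.exists_algebraMap_eq_of_isIntegral_pow (R := ↥L)
    (K := RatFunc k) (x := RatFunc.X) (n := 2) two_pos (isIntegral_algebraMap (x := (⟨_, hX2⟩ : ↥L)))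
  exact hXL (hy ▸ y.2)

end Cusp

/-! ## The strengthening "stage `m = 0` is already regular" is false -/

/-- **Stage zero does not suffice** (every prime `p`): the crux's antecedent with its conclusion
`∃ m, IsRegularLocalRing ↥(tower A m)` strengthened to `IsRegularLocalRing ↥(tower A 0)` (and nothing
else changed: the `let`-telescope is the route file's, byte for byte) is FALSE — witness the cusp
`A = 𝔽_p[t², t³] ⊆ O = 𝔽_p[t]_(t) ⊆ K = 𝔽_p(t)`. [folklore] -/
theorem syzygyTower_stageZero_false (p : ℕ) (hp : p.Prime) :
    ¬ (∀ (k K : Type) [Field k] [CharP k p] [Field K] [Algebra k K] (O : ValuationSubring K) (A : Subalgebra k K), (∀ c : k, algebraMap k K c ∈ O) → A.FG → IsFractionRing ↥A K → A.toSubring ≤ O.toSubring → (∀ y : K, y ∈ O → ∃ f : Polynomial k, f ≠ 0 ∧ O.valuation (Polynomial.aeval y f) < 1) → let n : ℕ := Cardinal.toNat (Algebra.trdeg k K); let J : (B : Subalgebra k K) → Ideal ↥B := fun B => sInf ((fun 𝔭 : PrimeSpectrum ↥B => 𝔭.asIdeal) '' {𝔭 : PrimeSpectrum ↥B | ¬ IsRegularLocalRing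 (Localization.AtPrime 𝔭.asIdeal)}); let loc : Subalgebra k K → Subalgebra k K := fun B => Algebra.adjoin k {y : K | ∃ a ∈ B, ∃ s ∈ B, s⁻¹ ∈ O ∧ y = a * s⁻¹}; let chart : Subalgebra k K → Subalgebra k K := fun B => Algebra.adjoin k ((B : Set K) ∪ {y : K | ∃ (b : ℕ → ℕ) (d : (i : ℕ) → ((Fin (b (i + 1)) → ↥B) →ₗ[↥B] (Fin (b i) → ↥B))) (ε : (Fin (b 0) → ↥B) →ₗ[↥B] (↥B ⧸ J B)) (r : ℕ) (ι : ↥(LinearMap.range (d (n - 1))) →ₗ[↥B] (Fin r → ↥B)), Function.Surjective ε ∧ Function.Exact (d 0) ε ∧ (∀ i : ℕ, Function.Exact (d (i + 1)) (d i)) ∧ Function.Injective ι ∧ (∀ z : Fin r → ↥B, ∃ a : ↥B, a ≠ 0 ∧ a • z ∈ LinearMap.range ι) ∧ ∃ g x : Fin r → ↥(LinearMap.range (d (n - 1))), Matrix.det (Matrix.of fun i j => ((ι (x i) j : ↥B) : K)) ≠ 0 ∧ (∀ g' : Fin r → ↥(LinearMap.range (d (n - 1))), Matrix.det (Matrix.of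 fun i j => ((ι (g' i) j : ↥B) : K)) * (Matrix.det (Matrix.of fun i j => ((ι (x i) j : ↥B) : K)))⁻¹ ∈ O) ∧ y = Matrix.det (Matrix.of fun i j => ((ι (g i) j : ↥B) : K)) * (Matrix.det (Matrix.of fun i j => ((ι (x i) j : ↥B) : K)))⁻¹}); let nrm : Subalgebra k K → Subalgebra k K := fun B => Algebra.adjoin k {y : K | IsIntegral ↥B y}; let tower : Subalgebra k K → ℕ → Subalgebra k K := fun A m => @Nat.rec (fun _ => Subalgebra k K) (loc A) (fun _ B => loc (nrm (chart B))) m; IsRegularLocalRing ↥(tower A 0)) := by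
  intro H
  haveI : Fact p.Prime := ⟨hp⟩
  obtain ⟨S, hS⟩ := cusp_envelope ((Polynomial.idealX (ZMod p)).valuation (RatFunc (ZMod p))) rfl
  have hO : ∀ z, z ∈ ((Polynomial.idealX (ZMod p)).valuation (RatFunc (ZMod p))).valuationSubring ↔
      (Polynomial.idealX (ZMod p)).valuation (RatFunc (ZMod p)) z ≤ 1 :=
    fun z => Valuation.mem_valuationSubring_iff _ _
  have hk : ∀ c : ZMod p, algebraMap (ZMod p) (RatFunc (ZMod p)) c ∈
      ((Polynomial.idealX (ZMod p)).valuation (RatFunc (ZMod p))).valuationSubring :=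
    fun c => (hO _).2 (cusp_v_C_le _ rfl c)
  have hAS : Algebra.adjoin (ZMod p) {(RatFunc.X : RatFunc (ZMod p)) ^ 2, (RatFunc.X : RatFunc (ZMod p)) ^ 3} ≤ S := by
    refine Algebra.adjoin_le ?_
    rintro z (rfl | rfl)
    · exact cusp_pow_mem_envelope _ rfl S hS 2 le_rfl
    · exact cusp_pow_mem_envelope _ rfl S hS 3 (by norm_num)
  have hFG : (Algebra.adjoin (ZMod p) {(RatFunc.X : RatFunc (ZMod p)) ^ 2, (RatFunc.X : RatFunc (ZMod p)) ^ 3}).FG :=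
    Subalgebra.fg_def.2 ⟨_, Set.toFinite _, rfl⟩
  haveI hfrac : IsFractionRing ↥(Algebra.adjoin (ZMod p) {(RatFunc.X : RatFunc (ZMod p)) ^ 2, (RatFunc.X : RatFunc (ZMod p)) ^ 3}) (RatFunc (ZMod p)) :=
    cusp_isFractionRing _ le_rfl
  have hAO : (Algebra.adjoin (ZMod p) {(RatFunc.X : RatFunc (ZMod p)) ^ 2, (RatFunc.X : RatFunc (ZMod p)) ^ 3}).toSubring ≤
      ((Polynomial.idealX (ZMod p)).valuation (RatFunc (ZMod p))).valuationSubring.toSubring :=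
    fun z hz => (hO z).2 ((hS z).1 (hAS hz)).1
  have H' := H (ZMod p) (RatFunc (ZMod p)) _ _ hk hFG hfrac hAO (cusp_dimZero _ rfl _ hO)
  dsimp only at H'
  refine cusp_not_isRegularLocalRing (k := ZMod p) _ ?_ ?_ H'
  · intro z hz
    exact Algebra.subset_adjoin ⟨z, hz, 1, Subalgebra.one_mem _, by rw [inv_one]; exact one_mem _,
      by rw [inv_one, mul_one]⟩
  · exact fun hX => cusp_X_not_mem_envelope _ rfl S hS (cusp_loc_le_envelope _ rfl _ hO S hS hX)

end Summit.ResolutionOfSingularities.ResolutionOfSingularities.Theorems.Globalisation.Negative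

end
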